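import Literature.NumberTheory.LFunctions.BaezDuarteSequentialNecessityProofs
import Literature.NumberTheory.LFunctions.QuasiRHFactsProofs
import HarnessLib

/-!
# σ-INDEXED RH-TYPE EQUIVALENCE (PROVED) · Báez-Duarte's Theorem 1.2 `BaezDuarte2005_thm_1_2` — "`ζ(s) ≠ 0` on `Re s > 2(1−α)` ⟺ `c_k ≪ k^{−α+ε}`" (`1/2 ≤ α ≤ 3/4`) DISCHARGED (`BaezDuarte2005_thm_1_2_holds`); nothing here bears on the truth of RH

Literature-typing tranche `rh-lit-broughan-2` (Broughan, *Equivalents of the Riemann Hypothesis*,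
Vol. 2, Ch. 2; Báez-Duarte 2005 Remark 1.2 / Thm. 1.2: "It is quite obvious how one can trivially
modify the proof of the theorem to obtain a more general result: A necessary and sufficient condition
for `ζ(s) ≠ 0` in the half-plane `Re(s) > 2(1−α)` is `c_k ≪ k^{−α+ε}` (∀ ε > 0)"). The named fact
`BaezDuarte2005_thm_1_2` (file `RieszTypeSeriesCriteria`) records this for `1/2 ≤ α ≤ 3/4`. Both
directions are PROVED here by the announced modification of the tree's proof of Theorem 1.1
(`BaezDuarteSequentialProofs`, `BaezDuarteSequentialNecessityProofs`):

* "⟹" (§1): a zero-free half-plane `Re s > θ := 2(1−α)` gives `M(x) = O(x^{θ+η})` (the tree's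
  PROVED quasi-RH Mertens dictionary `mertens_isBigO_of_quasiRiemannHypothesis_holds`, Titchmarsh
  Thm 14.25; for `α = 1/2`, i.e. `θ = 1`, the trivial `|M(n)| ≤ n`), and the summation by parts of
  `c_k = Σ μ(n) n^{−2}(1−n^{−2})^k` (`hasSum_baezDuarteCoeff_moebius`, weight estimate
  `abs_bdWeight_sub_le` with `a = α − ε`) gives `c_k ≪ k^{−α+ε}`
  (`abs_baezDuarteCoeff_le_of_mertens_bound`, `baezDuarteCoeff_isBigO_of_zeroFree`).
* "⟸" (§2): `c_k ≪ k^{−α+ε}` gives `F(x) ≪ x^{1−α+ε}` for Riesz's function (the tree's transfer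
  `rieszFunction_isBigO_of_baezDuarteCoeff_isBigO`), hence the Mellin transform of `F` is holomorphic
  on `−1 < Re z < α − 1 − ε` (`differentiableAt_mellin_rieszFunction_of_isBigO`, the tree's
  `differentiableAt_mellin_rieszFunction` with a general exponent); the identity
  `M(z) ζ(−2z) = Γ(z+1)` (`mellin_rieszFunction_mul_riemannZeta`) persists on the punctured strip by
  analytic continuation, and a zero `ρ` with `2(1−α) < Re ρ < 1` would force `Γ(1 − ρ/2) = 0`
  (`riemannZeta_ne_zero_of_baezDuarteCoeff_isBigO`) — verbatim the tree's argument for Thm 1.1 with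
  `1/4` replaced by `1 − α`.
* §3 **`BaezDuarte2005_thm_1_2_holds`** (at `α = 3/4` this re-proves `BaezDuarte2005_thm_1_1_holds` via the
  tree's `BaezDuarte2005_thm_1_1_of_thm_1_2`; not restated, dedup).

No new definitions, no new facts (D-0026); standard axioms only.

## References

* [BaezDuarte2005] L. Báez-Duarte, *A sequential Riesz-like criterion for the Riemann hypothesis*,
  IJMMS 2005:21 (arXiv:math/0307215), Thm. 1.2, Remark 1.2, §§2–3 [corpus: paper:arxiv-math_0307215 pp. 1, 4–5].
* [Titchmarsh1986] E. C. Titchmarsh, *The Theory of the Riemann Zeta-Function*, 2nd ed., Thm 14.25,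
  §14.32.
* [Broughan2017] K. Broughan, *Equivalents of the Riemann Hypothesis*, Vol. 2, Ch. 2 (secondary; not held).
-/

noncomputable section

open Filter Asymptotics Finset Topology Complex MeasureTheory Set

open scoped Real Nat

namespace Literature.NumberTheory.LFunctions

/-! ## §1 Zero-free half-plane ⟹ `c_k ≪ k^{−α+ε}` -/

/-- The summation-by-parts estimate of Báez-Duarte §3 with a general Mertens exponent: if
`|M(n)| ≤ C n^θ` (`n ≥ 1`) and `0 ≤ a ≤ 1`, `η > 0` with `2a − 3 + θ = −1 − η`, then
`|c_k| ≤ 16 C (Σ_n n^{−1−η}) k^{−a}` for all `k ≥ 1`. [cite: BaezDuarte2005, §3 and Remark 1.2 ("trivially modify the proof")] -/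
theorem abs_baezDuarteCoeff_le_of_mertens_bound {C θ a η : ℝ} (hC0 : 0 ≤ C)
    (hC : ∀ n : ℕ, 1 ≤ n → |(mertensFunction (n : ℝ) : ℝ)| ≤ C * (n : ℝ) ^ θ)
    (ha0 : 0 ≤ a) (ha1 : a ≤ 1) (hη : 0 < η) (hexp : 2 * a - 3 + θ = -1 - η) {k : ℕ} (hk : 1 ≤ k) :
    |baezDuarteCoeff k| ≤ 16 * C * (∑' n : ℕ, (n : ℝ) ^ (-1 - η)) * (k : ℝ) ^ (-a) := by
  have hk0 : (0 : ℝ) < k := by exact_mod_cast hk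
  have hZs : Summable fun n : ℕ ↦ (n : ℝ) ^ (-1 - η) := Real.summable_nat_rpow.2 (by linarith)
  set Z : ℝ := ∑' n : ℕ, (n : ℝ) ^ (-1 - η) with hZ
  -- weight and coefficients
  set f : ℕ → ℝ := fun n ↦ ((n : ℝ) ^ 2)⁻¹ * (1 - ((n : ℝ) ^ 2)⁻¹) ^ k with hf
  set c : ℕ → ℝ := fun n ↦ ((ArithmeticFunction.moebius n : ℤ) : ℝ) with hc
  have hcS : ∀ i : ℕ, ∑ j ∈ range (i + 1), c j = (mertensFunction (i : ℝ) : ℝ) :=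
    fun i ↦ sum_range_succ_moebius_eq_mertensFunction i
  have hf0 : ∀ n : ℕ, 1 ≤ n → 0 ≤ f n ∧ f n ≤ ((n : ℝ) ^ 2)⁻¹ := by
    intro n hn
    have hn1 : (1 : ℝ) ≤ n := by exact_mod_cast hn
    have hy1 : ((n : ℝ) ^ 2)⁻¹ ≤ 1 := inv_le_one_of_one_le₀ (one_le_pow₀ hn1)
    have hy0 : 0 ≤ 1 - ((n : ℝ) ^ 2)⁻¹ := by linarith
    have hy0' : 0 ≤ ((n : ℝ) ^ 2)⁻¹ := by positivity
    refine ⟨by positivity, ?_⟩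
    calc f n = ((n : ℝ) ^ 2)⁻¹ * (1 - ((n : ℝ) ^ 2)⁻¹) ^ k := rfl
      _ ≤ ((n : ℝ) ^ 2)⁻¹ * 1 := by gcongr; exact pow_le_one₀ hy0 (by linarith)
      _ = ((n : ℝ) ^ 2)⁻¹ := mul_one _
  have hrep : HasSum (fun n ↦ f n * c n) (baezDuarteCoeff k) := hasSum_baezDuarteCoeff_moebius k
  -- boundary terms
  have h0 : Tendsto (fun n : ℕ ↦ f n * ∑ j ∈ range (n + 1), c j) atTop (𝓝 0) := by
    have hlim : Tendsto (fun n : ℕ ↦ (1 : ℝ) / (n : ℝ)) atTop (𝓝 0) :=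
      tendsto_const_div_atTop_nhds_zero_nat 1
    refine squeeze_zero_norm' ?_ hlim
    filter_upwards [eventually_ge_atTop 1] with n hn
    have hn0 : (0 : ℝ) < n := by exact_mod_cast hn
    obtain ⟨hfn0, hfn⟩ := hf0 n hn
    rw [hcS, Real.norm_eq_abs, abs_mul, abs_of_nonneg hfn0]
    calc f n * |(mertensFunction (n : ℝ) : ℝ)| ≤ ((n : ℝ) ^ 2)⁻¹ * n := by
          gcongr
          exact MertensDictionary.abs_mertensFunction_natCast_le n
      _ = 1 / n := by field_simp
  -- domination
  have hB : ∀ N : ℕ, ∑ i ∈ range N, |f (i + 1) - f i| * |∑ j ∈ range (i + 1), c j| ≤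
      16 * C * Z * (k : ℝ) ^ (-a) := by
    intro N
    have hterm : ∀ i ∈ range N, |f (i + 1) - f i| * |∑ j ∈ range (i + 1), c j| ≤
        16 * C * (k : ℝ) ^ (-a) * (i : ℝ) ^ (-1 - η) := by
      intro i _
      rw [hcS]
      rcases Nat.eq_zero_or_pos i with rfl | hi
      · simp [MertensDictionary.mertensFunction_zero, Real.zero_rpow (by linarith : (-1 - η : ℝ) ≠ 0)]
      have hi0 : (0 : ℝ) < i := by exact_mod_cast hi
      have h1 : |f (i + 1) - f i| ≤ 16 * (k : ℝ) ^ (-a) * (i : ℝ) ^ (2 * a - 3) := by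
        have := abs_bdWeight_sub_le hk ha0 ha1 (n := i) hi
        simpa [hf, Nat.cast_add, Nat.cast_one] using this
      have h2 := hC i hi
      calc |f (i + 1) - f i| * |(mertensFunction (i : ℝ) : ℝ)|
          ≤ (16 * (k : ℝ) ^ (-a) * (i : ℝ) ^ (2 * a - 3)) * (C * (i : ℝ) ^ θ) :=
            mul_le_mul h1 h2 (abs_nonneg _) (by positivity)
        _ = 16 * C * (k : ℝ) ^ (-a) * ((i : ℝ) ^ (2 * a - 3) * (i : ℝ) ^ θ) := by ring
        _ = 16 * C * (k : ℝ) ^ (-a) * (i : ℝ) ^ (-1 - η) := by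
            rw [← Real.rpow_add hi0, hexp]
    calc ∑ i ∈ range N, |f (i + 1) - f i| * |∑ j ∈ range (i + 1), c j|
        ≤ ∑ i ∈ range N, 16 * C * (k : ℝ) ^ (-a) * (i : ℝ) ^ (-1 - η) := Finset.sum_le_sum hterm
      _ = 16 * C * (k : ℝ) ^ (-a) * ∑ i ∈ range N, (i : ℝ) ^ (-1 - η) := by rw [Finset.mul_sum]
      _ ≤ 16 * C * (k : ℝ) ^ (-a) * Z := by
          gcongr
          exact hZs.sum_le_tsum (range N) fun i _ ↦ Real.rpow_nonneg (Nat.cast_nonneg i) _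
      _ = 16 * C * Z * (k : ℝ) ^ (-a) := by ring
  have hmain := abs_tsum_mul_le_of_abel hrep.summable h0 hB
  rw [hrep.tsum_eq] at hmain
  exact hmain

/-- A zero-free half-plane `Re s > 2(1−α)` (`1/2 ≤ α ≤ 3/4`) yields, for every `η > 0`, a Mertens
bound `|M(n)| ≤ C n^{2(1−α)+η}`: for `α > 1/2` by the tree's PROVED quasi-RH Mertens dictionary
(Titchmarsh Thm 14.25 (A) ⇒ (C)), for `α = 1/2` trivially. [cite: Titchmarsh1986, Thm 14.25 ((A) ⇒ (C)); BaezDuarte2005 §3] -/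
theorem exists_mertens_bound_of_zeroFree {α : ℝ} (hα : 1 / 2 ≤ α) (hα1 : α ≤ 3 / 4)
    (hZ : ∀ s : ℂ, 2 * (1 - α) < s.re → riemannZeta s ≠ 0) {η : ℝ} (hη : 0 < η) :
    ∃ C : ℝ, 0 ≤ C ∧ ∀ n : ℕ, 1 ≤ n →
      |(mertensFunction (n : ℝ) : ℝ)| ≤ C * (n : ℝ) ^ (2 * (1 - α) + η) := by
  rcases hα.eq_or_lt with heq | hlt
  · -- `α = 1/2`: the trivial bound `|M(n)| ≤ n ≤ n^{1+η}`
    refine ⟨1, zero_le_one, fun n hn ↦ ?_⟩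
    have hn1 : (1 : ℝ) ≤ n := by exact_mod_cast hn
    calc |(mertensFunction (n : ℝ) : ℝ)| ≤ n := MertensDictionary.abs_mertensFunction_natCast_le n
      _ = (n : ℝ) ^ (1 : ℝ) := (Real.rpow_one _).symm
      _ ≤ (n : ℝ) ^ (2 * (1 - α) + η) := Real.rpow_le_rpow_of_exponent_le hn1 (by rw [← heq]; linarith)
      _ = 1 * (n : ℝ) ^ (2 * (1 - α) + η) := (one_mul _).symm
  · set θ : ℝ := 2 * (1 - α) with hθ
    have hθ0 : 1 / 2 ≤ θ := by rw [hθ]; linarith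
    have hθ1 : θ < 1 := by rw [hθ]; linarith
    have hQ : QuasiRiemannHypothesis θ := fun s hs h1 _ ↦ hZ s h1 hs
    have hM := mertens_isBigO_of_quasiRiemannHypothesis_holds θ hθ0 hθ1 hQ η hη
    exact MertensDictionary.exists_bound_of_isBigO (by linarith) hM

/-- **Báez-Duarte Thm 1.2, "⟹" (PROVED):** if `ζ(s) ≠ 0` for `Re s > 2(1−α)` (`1/2 ≤ α ≤ 3/4`), then
`c_k ≪ k^{−α+ε}` for every `ε > 0`. [cite: BaezDuarte2005, Thm. 1.2 (necessity; Remark 1.2)] -/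
theorem baezDuarteCoeff_isBigO_of_zeroFree {α : ℝ} (hα : 1 / 2 ≤ α) (hα1 : α ≤ 3 / 4)
    (hZ : ∀ s : ℂ, 2 * (1 - α) < s.re → riemannZeta s ≠ 0) {ε : ℝ} (hε : 0 < ε) :
    (fun k : ℕ ↦ baezDuarteCoeff k) =O[atTop] fun k : ℕ ↦ (k : ℝ) ^ (-α + ε) := by
  -- reduce to `ε ≤ 1/4`
  wlog hε1 : ε ≤ 1 / 4 generalizing ε with H
  · have h1 := H (ε := 1 / 4) (by norm_num) le_rfl
    refine h1.trans (IsBigO.of_bound 1 ?_)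
    filter_upwards [eventually_ge_atTop 1] with k hk
    have hk1 : (1 : ℝ) ≤ k := by exact_mod_cast hk
    rw [one_mul, Real.norm_of_nonneg (by positivity), Real.norm_of_nonneg (by positivity)]
    exact Real.rpow_le_rpow_of_exponent_le hk1 (by linarith)
  set a : ℝ := α - ε with ha
  have ha0 : 0 ≤ a := by rw [ha]; linarith
  have ha1 : a ≤ 1 := by rw [ha]; linarith
  obtain ⟨C, hC0, hC⟩ := exists_mertens_bound_of_zeroFree hα hα1 hZ hε
  have hexp : 2 * a - 3 + (2 * (1 - α) + ε) = -1 - ε := by rw [ha]; ring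
  refine IsBigO.of_bound (16 * C * ∑' n : ℕ, (n : ℝ) ^ (-1 - ε)) ?_
  filter_upwards [eventually_ge_atTop 1] with k hk
  have h := abs_baezDuarteCoeff_le_of_mertens_bound hC0 hC ha0 ha1 hε hexp hk
  have hka : (k : ℝ) ^ (-a) = (k : ℝ) ^ (-α + ε) := by rw [ha]; ring_nf
  rw [Real.norm_eq_abs, Real.norm_of_nonneg (by positivity : (0 : ℝ) ≤ (k : ℝ) ^ (-α + ε)), ← hka]
  exact h

/-! ## §2 `c_k ≪ k^{−α+ε}` ⟹ zero-free half-plane `Re s > 2(1−α)` -/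

/-- **Growth ⟹ holomorphy (general exponent):** if `F(x) = O(x^e)` as `x → ∞`, then
`z ↦ ∫₀^∞ F(t) t^{z−1} dt` is holomorphic on `−1 < Re z < −e` (`F(t) = O(t)` at `0`); the tree's
`differentiableAt_mellin_rieszFunction` is the case `e = 1/4 + ε`.
[cite: Titchmarsh1986, §14.32 (convergence of ∫ F(x) x^{−s−1} dx for σ > e under F = O(x^e)); BaezDuarte2005 Remark 1.2] -/
theorem differentiableAt_mellin_rieszFunction_of_isBigO {e : ℝ}
    (he : rieszFunction =O[atTop] fun x : ℝ ↦ x ^ e) {z : ℂ} (hz1 : -1 < z.re) (hz2 : z.re < -e) :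
    DifferentiableAt ℂ (mellin fun t : ℝ ↦ (rieszFunction t : ℂ)) z := by
  refine mellin_differentiableAt_of_isBigO_rpow (a := -e) (b := -1) ?_ ?_ hz2 ?_ hz1
  · exact (continuous_ofReal.comp continuous_rieszFunction).locallyIntegrable.locallyIntegrableOn _
  · refine (Complex.isBigO_ofReal_left.2 he).congr_right fun x ↦ ?_
    rw [neg_neg]
  · refine IsBigO.of_bound (Real.exp 1) ?_
    filter_upwards [Ioo_mem_nhdsGT (zero_lt_one' ℝ)] with x hx
    rw [Complex.norm_real, neg_neg, Real.rpow_one, Real.norm_of_nonneg hx.1.le]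
    calc ‖rieszFunction x‖ ≤ |x| * Real.exp |x| := norm_rieszFunction_le x
      _ ≤ x * Real.exp 1 := by
          rw [abs_of_pos hx.1]
          exact mul_le_mul_of_nonneg_left (Real.exp_le_exp.2 hx.2.le) hx.1.le
      _ = Real.exp 1 * x := mul_comm _ _

/-- The punctured strip `{−1 < Re z < c} ∖ {−1/2}` (`c > −1/2`) is preconnected (private mirror of
the lemma in `RieszCriterionProofs`, union of four overlapping convex pieces).
[cite: Titchmarsh1986, §14.32 (analytic continuation of Γ(1−s)/ζ(2s))] -/
private theorem isPreconnected_strip_punctured' {c : ℝ} (hc : -1 / 2 < c) :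
    IsPreconnected {z : ℂ | (-1 < z.re ∧ z.re < c) ∧ z ≠ -1 / 2} := by
  have hA : IsPreconnected {z : ℂ | -1 < z.re ∧ z.re < -1 / 2} :=
    ((convex_halfSpace_re_gt (-1)).inter (convex_halfSpace_re_lt (-1 / 2))).isPreconnected
  have hB : IsPreconnected {z : ℂ | -1 / 2 < z.re ∧ z.re < c} :=
    ((convex_halfSpace_re_gt (-1 / 2)).inter (convex_halfSpace_re_lt c)).isPreconnected
  have hCp : IsPreconnected {z : ℂ | (-1 < z.re ∧ z.re < c) ∧ 0 < z.im} :=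
    (((convex_halfSpace_re_gt (-1)).inter (convex_halfSpace_re_lt c)).inter
      (convex_halfSpace_im_gt 0)).isPreconnected
  have hCm : IsPreconnected {z : ℂ | (-1 < z.re ∧ z.re < c) ∧ z.im < 0} :=
    (((convex_halfSpace_re_gt (-1)).inter (convex_halfSpace_re_lt c)).inter
      (convex_halfSpace_im_lt 0)).isPreconnected
  have h1 : IsPreconnected ({z : ℂ | -1 < z.re ∧ z.re < -1 / 2} ∪
      {z : ℂ | (-1 < z.re ∧ z.re < c) ∧ 0 < z.im}) := by
    refine IsPreconnected.union (⟨-3 / 4, 1⟩ : ℂ) ?_ ?_ hA hCp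
    · exact ⟨show (-1 : ℝ) < -3 / 4 by norm_num, show (-3 / 4 : ℝ) < -1 / 2 by norm_num⟩
    · exact ⟨⟨show (-1 : ℝ) < -3 / 4 by norm_num, show (-3 / 4 : ℝ) < c by linarith⟩,
        show (0 : ℝ) < 1 by norm_num⟩
  have h2 : IsPreconnected (({z : ℂ | -1 < z.re ∧ z.re < -1 / 2} ∪
      {z : ℂ | (-1 < z.re ∧ z.re < c) ∧ 0 < z.im}) ∪
      {z : ℂ | (-1 < z.re ∧ z.re < c) ∧ z.im < 0}) := by
    refine IsPreconnected.union (⟨-3 / 4, -1⟩ : ℂ) ?_ ?_ h1 hCm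
    · exact Or.inl ⟨show (-1 : ℝ) < -3 / 4 by norm_num, show (-3 / 4 : ℝ) < -1 / 2 by norm_num⟩
    · exact ⟨⟨show (-1 : ℝ) < -3 / 4 by norm_num, show (-3 / 4 : ℝ) < c by linarith⟩,
        show (-1 : ℝ) < 0 by norm_num⟩
  have h3 : IsPreconnected ((({z : ℂ | -1 < z.re ∧ z.re < -1 / 2} ∪
      {z : ℂ | (-1 < z.re ∧ z.re < c) ∧ 0 < z.im}) ∪
      {z : ℂ | (-1 < z.re ∧ z.re < c) ∧ z.im < 0}) ∪
      {z : ℂ | -1 / 2 < z.re ∧ z.re < c}) := by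
    refine IsPreconnected.union (⟨(-1 / 2 + c) / 2, 1⟩ : ℂ) ?_ ?_ h2 hB
    · exact Or.inl (Or.inr ⟨⟨show (-1 : ℝ) < (-1 / 2 + c) / 2 by linarith,
        show ((-1 / 2 + c) / 2 : ℝ) < c by linarith⟩, show (0 : ℝ) < 1 by norm_num⟩)
    · exact ⟨show (-1 / 2 : ℝ) < (-1 / 2 + c) / 2 by linarith,
        show ((-1 / 2 + c) / 2 : ℝ) < c by linarith⟩
  convert h3 using 1
  ext z
  simp only [mem_union, mem_setOf_eq]
  have hre : (-1 / 2 : ℂ).re = -1 / 2 := by norm_num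
  have him : (-1 / 2 : ℂ).im = 0 := by norm_num
  constructor
  · rintro ⟨⟨h1, h2⟩, hne⟩
    rcases lt_trichotomy z.im 0 with hlt | heq | hgt
    · exact Or.inl (Or.inr ⟨⟨h1, h2⟩, hlt⟩)
    · have hzre : z.re ≠ -1 / 2 := fun h ↦ hne (Complex.ext (by rw [h, hre]) (by rw [heq, him]))
      rcases lt_or_gt_of_ne hzre with hl | hg
      · exact Or.inl (Or.inl (Or.inl ⟨h1, hl⟩))
      · exact Or.inr ⟨hg, h2⟩
    · exact Or.inl (Or.inl (Or.inr ⟨⟨h1, h2⟩, hgt⟩))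
  · rintro (((⟨h1, h2⟩ | ⟨⟨h1, h2⟩, h3⟩) | ⟨⟨h1, h2⟩, h3⟩) | ⟨h1, h2⟩)
    · exact ⟨⟨h1, by linarith⟩, fun h ↦ by rw [h, hre] at h2; linarith⟩
    · exact ⟨⟨h1, h2⟩, fun h ↦ by rw [h, him] at h3; linarith⟩
    · exact ⟨⟨h1, h2⟩, fun h ↦ by rw [h, him] at h3; linarith⟩
    · exact ⟨⟨by linarith, h2⟩, fun h ↦ by rw [h, hre] at h1; linarith⟩

/-- **Báez-Duarte Thm 1.2, "⟸" (PROVED):** if `c_k ≪ k^{−α+ε}` for every `ε > 0` (`1/2 ≤ α ≤ 3/4`),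
then `ζ(s) ≠ 0` for `Re s > 2(1−α)`: `F(x) ≪ x^{1−α+ε}` by the Poissonisation transfer, so the Mellin
transform of `F` is holomorphic on `−1 < Re z < α − 1 − ε` and `M(z)ζ(−2z) = Γ(z+1)` persists there
(punctured at `−1/2`); a zero `ρ` with `2(1−α) < Re ρ < 1` gives `Γ(1 − ρ/2) = 0`, impossible, while
`Re ρ ≥ 1` is excluded by Mathlib's `riemannZeta_ne_zero_of_one_le_re`.
[cite: BaezDuarte2005, Thm. 1.2 (sufficiency; Remark 1.2, proof of Prop. 2.1); Titchmarsh1986 §14.32] -/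
theorem riemannZeta_ne_zero_of_baezDuarteCoeff_isBigO {α : ℝ} (hα : 1 / 2 ≤ α) (hα1 : α ≤ 3 / 4)
    (h : ∀ ε : ℝ, 0 < ε →
      (fun k : ℕ ↦ baezDuarteCoeff k) =O[atTop] fun k : ℕ ↦ (k : ℝ) ^ (-α + ε)) :
    ∀ s : ℂ, 2 * (1 - α) < s.re → riemannZeta s ≠ 0 := by
  intro ρ hρ hζ
  -- zeros with `Re ρ ≥ 1` do not exist
  rcases le_or_gt 1 ρ.re with h1 | hρ1
  · exact riemannZeta_ne_zero_of_one_le_re h1 hζ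
  -- the point `z₀ = -ρ/2`, the margin `ε`, the exponent `a = α - ε`, the abscissa `c = a - 1`
  set z₀ : ℂ := -ρ / 2 with hz₀
  have hz₀re : z₀.re = -ρ.re / 2 := by simp [hz₀]
  set ε : ℝ := (α - 1 - z₀.re) / 2 with hε
  have hεpos : 0 < ε := by rw [hε, hz₀re]; linarith
  set a : ℝ := α - ε with ha
  have ha0 : 0 ≤ a := by rw [ha, hε, hz₀re]; linarith
  have ha1 : a ≤ 1 := by rw [ha, hε, hz₀re]; linarith
  set c : ℝ := a - 1 with hc
  have hz₀c : z₀.re < c := by rw [hc, ha, hε]; linarith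
  have hz₀1 : -1 < z₀.re := by rw [hz₀re]; linarith
  have hc1 : -1 / 2 < c := by linarith
  have hre : (-1 / 2 : ℂ).re = -1 / 2 := by norm_num
  -- `F = O(x^{1-a})`
  have hO : rieszFunction =O[atTop] fun x : ℝ ↦ x ^ (1 - a) :=
    rieszFunction_isBigO_of_baezDuarteCoeff_isBigO ha0 ha1
      ((h ε hεpos).congr_right fun k ↦ by rw [ha]; ring_nf)
  -- the domain of continuation
  have hUo : IsOpen {z : ℂ | (-1 < z.re ∧ z.re < c) ∧ z ≠ -1 / 2} :=
    ((isOpen_lt continuous_const continuous_re).inter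
      (isOpen_lt continuous_re continuous_const)).inter isOpen_ne
  have hΦ : AnalyticOnNhd ℂ
      (fun z ↦ mellin (fun t : ℝ ↦ (rieszFunction t : ℂ)) z * riemannZeta (-2 * z))
      {z : ℂ | (-1 < z.re ∧ z.re < c) ∧ z ≠ -1 / 2} := by
    refine DifferentiableOn.analyticOnNhd
      (fun z hz ↦ DifferentiableAt.differentiableWithinAt ?_) hUo
    refine (differentiableAt_mellin_rieszFunction_of_isBigO hO hz.1.1
      (by rw [hc] at hz; linarith [hz.1.2])).mul ?_
    refine (differentiableAt_riemannZeta ?_).comp z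
      ((differentiableAt_const _).mul differentiableAt_id)
    intro h'
    exact hz.2 (by linear_combination (-1 / 2 : ℂ) * h')
  have hΨ : AnalyticOnNhd ℂ (fun z ↦ Gamma (z + 1))
      {z : ℂ | (-1 < z.re ∧ z.re < c) ∧ z ≠ -1 / 2} := by
    refine DifferentiableOn.analyticOnNhd
      (fun z hz ↦ DifferentiableAt.differentiableWithinAt ?_) hUo
    refine (differentiableAt_Gamma _ fun m hm ↦ ?_).comp z
      (differentiableAt_id.add (differentiableAt_const _))
    have := congrArg re hm
    simp only [add_re, one_re, neg_re, natCast_re] at this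
    linarith [hz.1.1, (Nat.cast_nonneg m : (0 : ℝ) ≤ m)]
  -- they agree near `-3/4`
  have hz₁ : (⟨-3 / 4, 0⟩ : ℂ) ∈ {z : ℂ | (-1 < z.re ∧ z.re < c) ∧ z ≠ -1 / 2} :=
    ⟨⟨show (-1 : ℝ) < -3 / 4 by norm_num, show (-3 / 4 : ℝ) < c by linarith⟩,
      fun h0 ↦ by have := congrArg re h0; rw [hre] at this; norm_num at this⟩
  have heq : (fun z ↦ mellin (fun t : ℝ ↦ (rieszFunction t : ℂ)) z * riemannZeta (-2 * z))
      =ᶠ[𝓝 (⟨-3 / 4, 0⟩ : ℂ)] fun z ↦ Gamma (z + 1) := by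
    have hV : {z : ℂ | -1 < z.re ∧ z.re < -1 / 2} ∈ 𝓝 (⟨-3 / 4, 0⟩ : ℂ) :=
      ((isOpen_lt continuous_const continuous_re).inter
        (isOpen_lt continuous_re continuous_const)).mem_nhds
        ⟨show (-1 : ℝ) < -3 / 4 by norm_num, show (-3 / 4 : ℝ) < -1 / 2 by norm_num⟩
    exact eventuallyEq_of_mem hV fun z hz ↦ mellin_rieszFunction_mul_riemannZeta hz.1 hz.2
  have hEq := hΦ.eqOn_of_preconnected_of_eventuallyEq hΨ (isPreconnected_strip_punctured' hc1)
    hz₁ heq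
  -- evaluate at `z₀`
  have hz₀U : z₀ ∈ {z : ℂ | (-1 < z.re ∧ z.re < c) ∧ z ≠ -1 / 2} :=
    ⟨⟨hz₀1, hz₀c⟩, fun h0 ↦ by
      have := congrArg re h0
      rw [hz₀re, hre] at this
      linarith⟩
  have key := hEq hz₀U
  dsimp only at key
  have hρ' : -2 * z₀ = ρ := by rw [hz₀]; ring
  rw [hρ', hζ, mul_zero] at key
  exact Gamma_ne_zero_of_re_pos (by simp only [add_re, one_re]; linarith) key.symm

/-! ## §3 The discharge -/

/-- **DISCHARGE of the named fact `BaezDuarte2005_thm_1_2`** (Báez-Duarte 2005, Thm. 1.2: "A necessary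
and sufficient condition for `ζ(s) ≠ 0` in the half-plane `Re(s) > 2(1−α)` is `c_k ≪ k^{−α+ε}`
(∀ ε > 0)", recorded for `1/2 ≤ α ≤ 3/4`): a THEOREM of the tree. A family of equivalences is
proved; no zero-free region is asserted. [cite: BaezDuarte2005, Thm. 1.2 and Remark 1.2] -/
theorem BaezDuarte2005_thm_1_2_holds : BaezDuarte2005_thm_1_2 :=
  fun _α hα hα1 ↦ ⟨fun hZ _ε hε ↦ baezDuarteCoeff_isBigO_of_zeroFree hα hα1 hZ hε,
    riemannZeta_ne_zero_of_baezDuarteCoeff_isBigO hα hα1⟩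

end Literature.NumberTheory.LFunctions

end
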